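import Summits.QuantumFields.BalabanUV.Beta.GAN24.WardResidualRotatedVertexMass

/-!
# `BalabanUV.Beta.GAN24.WardResidualRotatedVertexPeriodic` — binder row G-an2-4 ∕ (CONV-C), CT-W route «WC-TL» → «QR-LL», the OWNER gan24-p1 g26's CHARGE AUDIT ∕
# located identity of record (S) (R12): **THE SLOT MOMENTS OF THE (α) PIECE AGAINST ANY BLOCK-PERIODIC CHARGE FUNCTIONAL** — (M0) = 0, the slot-dipole in
# closed form and label-free, for the charges the next S-step ACTUALLY sees (the TRANSPORTED letter `−(cE·wE)•mmRead(G ∘ (α) ∘ G)` reads (α)'s tables through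
# block-periodic face weights — p2 g35's `SandwichReadoutSiteDep.hasSum_sandwich_readout_coDressKBmAt`), not only the plain pair charge of `WardResidualRotatedVertexMass`
# (road-P2 chair `b2b-balaban-gan24-p2`, gen 38, INTENT 4)

NOT IN PRINT; OUR BOOKKEEPING ([folklore] slot bookkeeping; the kernel-side covariance is `WardResidualRotatedVertexMass` §1 ∕ §4 BY NAME; 0 `def`, 0 cited fact,
0 `def … : Prop`, 0 sorry).  HONEST FRAMING (cell contract, verbatim): «discharging `BetaPertH` makes Bałaban's UV stability UNCONDITIONAL — a real constructive-QFT
result; it is NOT the continuum limit and NOT the Clay problem.»  HONEST DEPENDENCY (verbatim): «continuum YM on T⁴ ⇐ BetaPertH ∧ nine spine estimates (0/9 proved);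
BetaPertH ⇐ (D1) ∧ (D4) ∧ CAP+tail; G-an2-4 gates asym, D1 and NE2/3/4.»

WHAT.  By `WardResidualRotatedVertex.rotatedVertex_eq`, (α) at slot `(ν, y′)` is the `dM`-read of `G_{j+1}` on the reweighted tables; ANY real functional of (α) that is
LINEAR through the `dM`-read is therefore the slot function
`V_Z(y′) := ½·[Σ_κ Σ'_u colH G_{j+1} ν y′ κ u·(½𝟙[y′=y] − ½𝟙[blk u = y])·Z_S(κ,u) + Σ_ρ′ Σ'_w colM G_{j+1} ν y′ ρ′ w·(½𝟙[y′=y] − ½𝟙[w=y])·Z_M(ρ′,w)]`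
for the functional's values `Z_S(κ,u)`, `Z_M(ρ′,w)` on the first-order letters (plain pair charges: `WardResidualRotatedVertex.hasSum_prod_rotatedVertex_comb`; face-weighted pair
charges of the transported letter: the same display with the sandwich's leg weights).  HYPOTHESES (displayed, discharged nowhere here): `Z_S` BLOCK-PERIODIC with `u ↦ colH G ν y κ u·Z_S(κ,u)` summable
(`Z_S(κ, Lc•t + v) = Z_S(κ, v)`; summability e.g. from `|Z_S| ≤ B`, `summable_colH_mul_of_bdd` — true for any bounded block-periodic two-leg weight against the block-covariant
comb tables), `Z_M` slot-CONSTANT (`Z_M(ρ′,w) = Z_M(ρ′,0)`).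
* §1 `summable_colH_mul_of_bdd`, `summable_colM_mul_of_const`, **`tsum_colH_mul_eq_blockSum_of_periodic`** (`Σ'_u colH G ν y κ u·Z_S(κ,u) = Σ_{v∈box} (Σ'_{y′} colH G ν y′ κ (Lc•y+v))·Z_S(κ,v)`),
  **`tsum_colM_mul_eq_of_const`**.
* §2 **`hasSum_totalCharge_of_periodic`**: `HasSum (y′ ↦ V_Z(y′)) 0` — (M0_y) FOR (α) AGAINST EVERY SUCH FUNCTIONAL (in particular for the transported letter's charges).
* §3 **`hasSum_slotMoment_of_periodic`**: `HasSum (y′ ↦ (y′−y)_λ·V_Z(y′)) (−¼·[Σ_κ Σ_{v∈box} (Σ'_t t_λ·colH G ν t κ v)·Z_S(κ,v) + Σ_ρ′ (Σ'_t t_λ·colM G ν t ρ′ 0)·Z_M(ρ′,0)])` —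
  the slot-dipole in closed form, LABEL-FREE: first moments of ONE coarse column of `G_{j+1}` against the functional's values on the block `B(0)`.
Asserts NO value of Bałaban's tables; discharges NOTHING of (S) ∕ (Q-R) ∕ (LT) ∕ (Q-L) ∕ (C) ∕ «T2Shape» ∕ «T2Drift» ∕ (hW, hWall); NEVER «G-an2-4 closed» as (CONV-C); NOT D1,
NOT BetaPertH, NOT continuum, NOT Clay.  2026-08-22; no existing file touched.
-/

noncomputable section

open Finset
open scoped BigOperators
open Literature.MathematicalPhysics.QuantumFieldTheory
open Literature.MathematicalPhysics.QuantumFieldTheory.Balaban1983to89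
open Literature.MathematicalPhysics.QuantumFieldTheory.Balaban1983to89.Beta
open B12Sec2to5 (l1)
open ExpKernelCalculus (Site MKer Decays summable_exp_shift')
open AffineAveraging (box toSite)
open AveragingContours (blk)
open OneStepResolventKernel (Fib)
open OneStepKernelFamily (KInvStep colH abs_colH_le)
open SecondOrderResponse (colM abs_colM_le)
open Summit.QuantumFields.BalabanUV.Beta.AxialDressingRooted (coDressKBmAt decays_coDressKBmAt_KInvStep)
open Summit.QuantumFields.BalabanUV.Beta.GAN24.ResolventLegCharges (summable_exp_coarse')
open Summit.QuantumFields.BalabanUV.Beta.GAN24.KernelLegCharges (summable_exp_coarse)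
open Summit.QuantumFields.BalabanUV.Beta.GAN24.BiStencilZeroMode (tsum_eq_sum_box_tsum)
open Summit.QuantumFields.BalabanUV.Beta.GAN24.WardResidualRotatedVertexDipole (slotMoment_term_eq summable_slotMoment_colH summable_slotMoment_colM)
open Summit.QuantumFields.BalabanUV.Beta.GAN24.WardResidualRotatedVertexMass (colH_comb_block colM_comb_coarse charge_term_eq
  tsum_slotMoment_colH_labelFree tsum_slotMoment_colM_labelFree)

namespace Summit.QuantumFields.BalabanUV.Beta.GAN24.WardResidualRotatedVertexPeriodic

variable {d Lc : ℕ} [NeZero Lc]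

/-! ## §1 Summability and «column total = block sum of row totals» for a block-periodic functional -/

omit [NeZero Lc] in
/-- [folklore] A decaying column against a bounded slot function is summable over the fine slot. -/
theorem summable_colH_mul_of_bdd {K : MKer (d + 1) (Fib d)} {C δ : ℝ} (hK : Decays K C δ) (hδ : 0 < δ) (ν κ : Fin (d + 1)) (y : Site (d + 1))
    {Z : Site (d + 1) → ℝ} {B : ℝ} (hZ : ∀ u, |Z u| ≤ B) :
    Summable fun u : Site (d + 1) => colH K Lc ν y κ u * Z u := by
  refine Summable.of_norm_bounded ((summable_exp_shift' (D := d + 1) hδ ((Lc : ℤ) • y)).mul_left (C * B)) (fun u => ?_)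
  rw [Real.norm_eq_abs, abs_mul]
  have hB : 0 ≤ B := (abs_nonneg _).trans (hZ u)
  calc |colH K Lc ν y κ u| * |Z u| ≤ (C * Real.exp (-δ * l1 (u - (Lc : ℤ) • y))) * B :=
        mul_le_mul (abs_colH_le (N := Lc) hK ν y κ u) (hZ u) (abs_nonneg _) ((abs_nonneg _).trans (abs_colH_le (N := Lc) hK ν y κ u))
    _ = C * B * Real.exp (-δ * l1 (u - (Lc : ℤ) • y)) := by ring

omit [NeZero Lc] in
/-- [folklore] A decaying multiplier column against a slot-constant function is summable over the coarse slot. -/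
theorem summable_colM_mul_of_const (hLc : 1 ≤ Lc) {K : MKer (d + 1) (Fib d)} {C δ : ℝ} (hK : Decays K C δ) (hδ : 0 < δ) (ν ρ' : Fin (d + 1))
    (y : Site (d + 1)) {Z : Site (d + 1) → ℝ} (hZ : ∀ w, Z w = Z y) :
    Summable fun w : Site (d + 1) => colM K Lc ν y ρ' w * Z w := by
  simp only [hZ]
  refine Summable.of_norm_bounded ((summable_exp_coarse (d := d) hLc hδ ((Lc : ℤ) • y)).mul_left (C * |Z y|)) (fun w => ?_)
  rw [Real.norm_eq_abs, abs_mul]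
  calc |colM K Lc ν y ρ' w| * |Z y| ≤ (C * Real.exp (-δ * l1 ((Lc : ℤ) • w - (Lc : ℤ) • y))) * |Z y| :=
        mul_le_mul_of_nonneg_right (abs_colM_le (N := Lc) hK ν y ρ' w) (abs_nonneg _)
    _ = C * |Z y| * Real.exp (-δ * l1 ((Lc : ℤ) • w - (Lc : ℤ) • y)) := by ring

/-- NOT IN PRINT; OUR BOOKKEEPING.  **«COLUMN TOTAL = BLOCK SUM OF ROW TOTALS» FOR ANY BLOCK-PERIODIC BOUNDED FUNCTIONAL**: for the comb kernel
`G = coDressKBmAt ρ Lc (KInvStep Lc j)`, `Z(Lc•t + v) = Z(v)` and `u ↦ colH G ν y κ u·Z u` summable (e.g. `|Z| ≤ B`, `summable_colH_mul_of_bdd`):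
`Σ'_u colH G ν y κ u·Z u = Σ_{v∈box} (Σ'_{y′} colH G ν y′ κ (Lc•y + v))·Z(v)`. -/
theorem tsum_colH_mul_eq_blockSum_of_periodic (r : Fin (d + 1) → ℕ) (j : ℕ) (ν κ : Fin (d + 1)) (y : Site (d + 1))
    {Z : Site (d + 1) → ℝ} (hZp : ∀ (t : Site (d + 1)) (v : Fin (d + 1) → ℕ), Z ((Lc : ℤ) • t + toSite v) = Z (toSite v))
    (hsum : Summable fun u : Site (d + 1) => colH (coDressKBmAt (toSite r) Lc (KInvStep (d := d) Lc j)) Lc ν y κ u * Z u) :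
    ∑' u : Site (d + 1), colH (coDressKBmAt (toSite r) Lc (KInvStep (d := d) Lc j)) Lc ν y κ u * Z u =
      ∑ v ∈ box (d + 1) Lc, (∑' y' : Site (d + 1), colH (coDressKBmAt (toSite r) Lc (KInvStep (d := d) Lc j)) Lc ν y' κ ((Lc : ℤ) • y + toSite v))
        * Z (toSite v) := by
  rw [tsum_eq_sum_box_tsum (N := Lc) hsum]
  refine Finset.sum_congr rfl fun v _ => ?_
  have e : ∀ t : Site (d + 1), colH (coDressKBmAt (toSite r) Lc (KInvStep (d := d) Lc j)) Lc ν y κ ((Lc : ℤ) • t + toSite v) * Z ((Lc : ℤ) • t + toSite v)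
      = colH (coDressKBmAt (toSite r) Lc (KInvStep (d := d) Lc j)) Lc ν (y + (y - t)) κ ((Lc : ℤ) • y + toSite v) * Z (toSite v) := fun t => by
    rw [colH_comb_block, hZp]
  simp only [e]
  rw [tsum_mul_right]
  congr 1
  have hre := (Equiv.subLeft (y + y)).tsum_eq (fun y' : Site (d + 1) => colH (coDressKBmAt (toSite r) Lc (KInvStep (d := d) Lc j)) Lc ν y' κ ((Lc : ℤ) • y + toSite v))
  rw [← hre]
  exact tsum_congr fun t => by rw [Equiv.subLeft_apply, add_sub_assoc]

omit [NeZero Lc] in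
/-- NOT IN PRINT; OUR BOOKKEEPING.  The multiplier twin for a slot-constant functional: `Σ'_w colM G ν y ρ′ w·Z w = (Σ'_{y′} colM G ν y′ ρ′ y)·Z y`. -/
theorem tsum_colM_mul_eq_of_const [NeZero Lc] (r : Fin (d + 1) → ℕ) (j : ℕ) (ν ρ' : Fin (d + 1)) (y : Site (d + 1)) {Z : Site (d + 1) → ℝ}
    (hZ : ∀ w, Z w = Z y) :
    ∑' w : Site (d + 1), colM (coDressKBmAt (toSite r) Lc (KInvStep (d := d) Lc j)) Lc ν y ρ' w * Z w =
      (∑' y' : Site (d + 1), colM (coDressKBmAt (toSite r) Lc (KInvStep (d := d) Lc j)) Lc ν y' ρ' y) * Z y := by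
  have e : ∀ w : Site (d + 1), colM (coDressKBmAt (toSite r) Lc (KInvStep (d := d) Lc j)) Lc ν y ρ' w * Z w
      = colM (coDressKBmAt (toSite r) Lc (KInvStep (d := d) Lc j)) Lc ν (y + (y - w)) ρ' y * Z y := fun w => by
    rw [colM_comb_coarse, hZ]
  simp only [e]
  rw [tsum_mul_right]
  congr 1
  have hre := (Equiv.subLeft (y + y)).tsum_eq (fun y' : Site (d + 1) => colM (coDressKBmAt (toSite r) Lc (KInvStep (d := d) Lc j)) Lc ν y' ρ' y)
  rw [← hre]
  exact tsum_congr fun t => by rw [Equiv.subLeft_apply, add_sub_assoc]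

/-! ## §2 (M0) against a block-periodic functional -/

/-- NOT IN PRINT; OUR BOOKKEEPING.  **(M0) FOR (α) AGAINST ANY BLOCK-PERIODIC FUNCTIONAL**: with `Z_S` block-periodic and bounded, `Z_M` slot-constant, the slot function
`V_Z` (the (α) `dM`-read profile, `WardResidualRotatedVertexMass.charge_term_eq`) has `HasSum (y′ ↦ V_Z(y′)) 0` — in particular the zeroth slot-moment of the TRANSPORTED
(α)-letter's face-weighted charges (once displayed in this form by the sandwich read-out) vanishes, at every label, slot direction, level, in-block root. -/
theorem hasSum_totalCharge_of_periodic (hLc : 1 ≤ Lc) {r : Fin (d + 1) → ℕ} (hr : r ∈ box (d + 1) Lc) (j : ℕ) (ν : Fin (d + 1)) (y : Site (d + 1))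
    {ZS ZM : Fin (d + 1) → Site (d + 1) → ℝ}
    (hZSp : ∀ (κ : Fin (d + 1)) (t : Site (d + 1)) (v : Fin (d + 1) → ℕ), ZS κ ((Lc : ℤ) • t + toSite v) = ZS κ (toSite v))
    (hsum : ∀ κ, Summable fun u : Site (d + 1) => colH (coDressKBmAt (toSite r) Lc (KInvStep (d := d) Lc j)) Lc ν y κ u * ZS κ u)
    (hZMc : ∀ ρ' w, ZM ρ' w = ZM ρ' y) :
    HasSum (fun y' : Site (d + 1) =>
        (1 / 2 : ℝ) *
          ((∑ κ : Fin (d + 1), ∑' u : Site (d + 1),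
              colH (coDressKBmAt (toSite r) Lc (KInvStep (d := d) Lc j)) Lc ν y' κ u
                * ((if y' = y then (1 / 2 : ℝ) else 0) - (if blk Lc u = y then (1 / 2 : ℝ) else 0)) * ZS κ u)
            + ∑ ρ' : Fin (d + 1), ∑' w : Site (d + 1),
              colM (coDressKBmAt (toSite r) Lc (KInvStep (d := d) Lc j)) Lc ν y' ρ' w
                * ((if y' = y then (1 / 2 : ℝ) else 0) - (if w = y then (1 / 2 : ℝ) else 0)) * ZM ρ' w)) 0 := by
  classical
  obtain ⟨δG, CG, hδG, hCG, hG⟩ := decays_coDressKBmAt_KInvStep (d := d) hr j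
  set G := coDressKBmAt (toSite r) Lc (KInvStep (d := d) Lc j) with hGdef
  have hsumM : ∀ ρ', Summable fun w : Site (d + 1) => colM G Lc ν y ρ' w * ZM ρ' w := fun ρ' => summable_colM_mul_of_const hLc hG hδG ν ρ' y (hZMc ρ')
  have hprof := fun y' => charge_term_eq hLc G ZS ZM y ν hsum hsumM y'
  have hZSy : ∀ (κ : Fin (d + 1)) (v : Fin (d + 1) → ℕ), ZS κ ((Lc : ℤ) • y + toSite v) = ZS κ (toSite v) := fun κ v => hZSp κ y v
  set V₀ : ℝ := (1 / 4 : ℝ) * ((∑ κ : Fin (d + 1), ∑' u : Site (d + 1), colH G Lc ν y κ u * ZS κ u)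
      + ∑ ρ' : Fin (d + 1), ∑' w : Site (d + 1), colM G Lc ν y ρ' w * ZM ρ' w) with hV₀
  have hδslot : HasSum (fun y' : Site (d + 1) => if y' = y then V₀ else 0) V₀ := hasSum_ite_eq y V₀
  have hH : ∀ (κ : Fin (d + 1)) (v : Fin (d + 1) → ℕ), HasSum (fun y' : Site (d + 1) =>
      colH G Lc ν y' κ ((Lc : ℤ) • y + toSite v) * ZS κ ((Lc : ℤ) • y + toSite v))
      ((∑' y' : Site (d + 1), colH G Lc ν y' κ ((Lc : ℤ) • y + toSite v)) * ZS κ ((Lc : ℤ) • y + toSite v)) := by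
    intro κ v
    refine (Summable.hasSum ?_).mul_right _
    refine Summable.of_norm_bounded ((summable_exp_coarse' (d := d) hLc hδG ((Lc : ℤ) • y + toSite v)).mul_left CG) (fun y' => ?_)
    rw [Real.norm_eq_abs]
    exact abs_colH_le (N := Lc) hG ν y' κ _
  have hM : ∀ ρ' : Fin (d + 1), HasSum (fun y' : Site (d + 1) => colM G Lc ν y' ρ' y * ZM ρ' y)
      ((∑' y' : Site (d + 1), colM G Lc ν y' ρ' y) * ZM ρ' y) := by
    intro ρ'
    refine (Summable.hasSum ?_).mul_right _
    refine Summable.of_norm_bounded ((summable_exp_coarse' (d := d) hLc hδG ((Lc : ℤ) • y)).mul_left CG) (fun y' => ?_)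
    rw [Real.norm_eq_abs]
    exact abs_colM_le (N := Lc) hG ν y' ρ' y
  have hblock := ((hasSum_sum (s := (Finset.univ : Finset (Fin (d + 1)))) fun κ _ =>
      hasSum_sum (s := box (d + 1) Lc) fun v _ => hH κ v).add
    (hasSum_sum (s := (Finset.univ : Finset (Fin (d + 1)))) fun ρ' _ => hM ρ')).mul_left (1 / 4 : ℝ)
  have htot := hδslot.sub hblock
  have hval : V₀ - (1 / 4 : ℝ) * ((∑ κ : Fin (d + 1), ∑ v ∈ box (d + 1) Lc,
        (∑' y' : Site (d + 1), colH G Lc ν y' κ ((Lc : ℤ) • y + toSite v)) * ZS κ ((Lc : ℤ) • y + toSite v))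
      + ∑ ρ' : Fin (d + 1), (∑' y' : Site (d + 1), colM G Lc ν y' ρ' y) * ZM ρ' y) = 0 := by
    rw [hV₀]
    have h1 : ∀ κ : Fin (d + 1), (∑' u : Site (d + 1), colH G Lc ν y κ u * ZS κ u)
        = ∑ v ∈ box (d + 1) Lc, (∑' y' : Site (d + 1), colH G Lc ν y' κ ((Lc : ℤ) • y + toSite v)) * ZS κ ((Lc : ℤ) • y + toSite v) := by
      intro κ
      rw [tsum_colH_mul_eq_blockSum_of_periodic r j ν κ y (hZSp κ) (hsum κ)]
      exact Finset.sum_congr rfl fun v _ => by rw [hZSy]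
    have h2 : ∀ ρ' : Fin (d + 1), (∑' w : Site (d + 1), colM G Lc ν y ρ' w * ZM ρ' w)
        = (∑' y' : Site (d + 1), colM G Lc ν y' ρ' y) * ZM ρ' y := fun ρ' => tsum_colM_mul_eq_of_const r j ν ρ' y (hZMc ρ')
    simp only [h1, h2]
    ring
  rw [hval] at htot
  refine htot.congr_fun fun y' => ?_
  rw [hprof y']

/-! ## §3 The slot-dipole against a block-periodic functional, closed and label-free -/

/-- NOT IN PRINT; OUR BOOKKEEPING.  **THE SLOT-DIPOLE OF (α) AGAINST ANY BLOCK-PERIODIC FUNCTIONAL, IN CLOSED LABEL-FREE FORM**: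
`HasSum (y′ ↦ (y′−y)_λ·V_Z(y′)) (−¼·[Σ_κ Σ_{v∈box} (Σ'_t t_λ·colH G ν t κ v)·Z_S(κ,v) + Σ_ρ′ (Σ'_t t_λ·colM G ν t ρ′ 0)·Z_M(ρ′,0)])` — the first moments of ONE
coarse column of `G_{j+1}` against the functional's values on the block `B(0)`; for the plain pair charge this is `WardResidualRotatedVertexMass.hasSum_slotMoment_rotatedVertex_comb_labelFree`,
for the transported letter's face-weighted charges it is the (α) side of (S) in the currency the next S-step reads. -/
theorem hasSum_slotMoment_of_periodic (hLc : 1 ≤ Lc) {r : Fin (d + 1) → ℕ} (hr : r ∈ box (d + 1) Lc) (j : ℕ) (ν lam : Fin (d + 1)) (y : Site (d + 1))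
    {ZS ZM : Fin (d + 1) → Site (d + 1) → ℝ}
    (hZSp : ∀ (κ : Fin (d + 1)) (t : Site (d + 1)) (v : Fin (d + 1) → ℕ), ZS κ ((Lc : ℤ) • t + toSite v) = ZS κ (toSite v))
    (hZMc : ∀ ρ' w, ZM ρ' w = ZM ρ' 0) :
    HasSum (fun y' : Site (d + 1) =>
        (((y' lam : ℤ) : ℝ) - ((y lam : ℤ) : ℝ)) *
          ((1 / 2 : ℝ) *
            ((∑ κ : Fin (d + 1), ∑' u : Site (d + 1),
                colH (coDressKBmAt (toSite r) Lc (KInvStep (d := d) Lc j)) Lc ν y' κ u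
                  * ((if y' = y then (1 / 2 : ℝ) else 0) - (if blk Lc u = y then (1 / 2 : ℝ) else 0)) * ZS κ u)
              + ∑ ρ' : Fin (d + 1), ∑' w : Site (d + 1),
                colM (coDressKBmAt (toSite r) Lc (KInvStep (d := d) Lc j)) Lc ν y' ρ' w
                  * ((if y' = y then (1 / 2 : ℝ) else 0) - (if w = y then (1 / 2 : ℝ) else 0)) * ZM ρ' w)))
      (-(1 / 4 : ℝ) *
        ((∑ κ : Fin (d + 1), ∑ v ∈ box (d + 1) Lc,
            (∑' t : Site (d + 1), ((t lam : ℤ) : ℝ) * colH (coDressKBmAt (toSite r) Lc (KInvStep (d := d) Lc j)) Lc ν t κ (toSite v)) * ZS κ (toSite v))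
          + ∑ ρ' : Fin (d + 1),
            (∑' t : Site (d + 1), ((t lam : ℤ) : ℝ) * colM (coDressKBmAt (toSite r) Lc (KInvStep (d := d) Lc j)) Lc ν t ρ' 0) * ZM ρ' 0)) := by
  obtain ⟨δG, CG, hδG, hCG, hG⟩ := decays_coDressKBmAt_KInvStep (d := d) hr j
  have hH : ∀ (κ : Fin (d + 1)) (v : Fin (d + 1) → ℕ), HasSum (fun y' : Site (d + 1) =>
      (((y' lam : ℤ) : ℝ) - ((y lam : ℤ) : ℝ)) * colH (coDressKBmAt (toSite r) Lc (KInvStep (d := d) Lc j)) Lc ν y' κ ((Lc : ℤ) • y + toSite v)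
        * ZS κ ((Lc : ℤ) • y + toSite v))
      ((∑' t : Site (d + 1), ((t lam : ℤ) : ℝ) * colH (coDressKBmAt (toSite r) Lc (KInvStep (d := d) Lc j)) Lc ν t κ (toSite v)) * ZS κ (toSite v)) := by
    intro κ v
    have h := (summable_slotMoment_colH hLc hG hδG ν κ ((Lc : ℤ) • y + toSite v) y lam).hasSum.mul_right (ZS κ ((Lc : ℤ) • y + toSite v))
    have hv : (∑' y' : Site (d + 1), (((y' lam : ℤ) : ℝ) - ((y lam : ℤ) : ℝ))
          * colH (coDressKBmAt (toSite r) Lc (KInvStep (d := d) Lc j)) Lc ν y' κ ((Lc : ℤ) • y + toSite v)) * ZS κ ((Lc : ℤ) • y + toSite v)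
        = (∑' t : Site (d + 1), ((t lam : ℤ) : ℝ) * colH (coDressKBmAt (toSite r) Lc (KInvStep (d := d) Lc j)) Lc ν t κ (toSite v)) * ZS κ (toSite v) := by
      rw [tsum_slotMoment_colH_labelFree, hZSp]
    rw [hv] at h
    exact h
  have hMs : ∀ ρ' : Fin (d + 1), HasSum (fun y' : Site (d + 1) =>
      (((y' lam : ℤ) : ℝ) - ((y lam : ℤ) : ℝ)) * colM (coDressKBmAt (toSite r) Lc (KInvStep (d := d) Lc j)) Lc ν y' ρ' y * ZM ρ' y)
      ((∑' t : Site (d + 1), ((t lam : ℤ) : ℝ) * colM (coDressKBmAt (toSite r) Lc (KInvStep (d := d) Lc j)) Lc ν t ρ' 0) * ZM ρ' 0) := by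
    intro ρ'
    have h := (summable_slotMoment_colM hLc hG hδG ν ρ' y y lam).hasSum.mul_right (ZM ρ' y)
    have hv : (∑' y' : Site (d + 1), (((y' lam : ℤ) : ℝ) - ((y lam : ℤ) : ℝ))
          * colM (coDressKBmAt (toSite r) Lc (KInvStep (d := d) Lc j)) Lc ν y' ρ' y) * ZM ρ' y
        = (∑' t : Site (d + 1), ((t lam : ℤ) : ℝ) * colM (coDressKBmAt (toSite r) Lc (KInvStep (d := d) Lc j)) Lc ν t ρ' 0) * ZM ρ' 0 := by
      rw [tsum_slotMoment_colM_labelFree, hZMc]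
    rw [hv] at h
    exact h
  have h := ((hasSum_sum (s := (Finset.univ : Finset (Fin (d + 1)))) fun κ _ =>
      hasSum_sum (s := box (d + 1) Lc) fun v _ => hH κ v).add
    (hasSum_sum (s := (Finset.univ : Finset (Fin (d + 1)))) fun ρ' _ => hMs ρ')).mul_left (-(1 / 4 : ℝ))
  refine h.congr_fun fun y' => ?_
  exact slotMoment_term_eq hLc _ ZS ZM y ν lam y'

end Summit.QuantumFields.BalabanUV.Beta.GAN24.WardResidualRotatedVertexPeriodic

end
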